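import Summits.QuantumFields.GaugeBoot.PeriodicSeedResum
import HarnessLib

/-!
# The volume-independent estimate of a localised back expansion on a periodic lattice (gauge-boot, L3 supplement: uniform reduced-half window, 4/6)

HONEST FRAMING (cell `pub-gaugeboot`, page 1 of every file): the venture produces certified bounds
on lattice expectations at stated coupling, gauge group, dimension and torus size; NOT a mass gap,
NOT a continuum limit, NOT a string tension; NOT Yang–Mills-summit-bearing (barriers
`FixedCouplingUltralocality`, `PerturbativeInvisibility`). This module is bookkeeping for a
structural NEGATIVE result (a coupling window UNIFORM in the box for the failure of the reduced-half
in-plane reflection positivities of the square tilted boxes in `d ≥ 3`); it discharges nothing by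
itself.

## Content (any periodic lattice `(A, e)`, `d ≥ 1`, compact metrisable `G`, continuous `ρ`, `β ≥ 0`)

The periodic-lattice version of the cubic-torus module `DiagonalRPTorusUniformEstimate` (gen 45,
written for `(ℤ/L)^d` only). A localised strong-coupling expansion of a plaquette-pair witness,
`Σ_{Q ⊆ R} combo(Q)` over the REST plaquettes `R` of a finite periodic lattice, is estimated with
NO dependence on `#R` or on the lattice, from the resummed form
`Σ_{Q₁ seed-connected} combo(Q₁) · restZ(R ∖ N[Q₁])` (`PeriodicSeedResum.sum_combo_eq_sum_seedConn`),
the ratio bounds and the entropy bound of `PeriodicSeedResum`: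

* **`sum_small_le`** — over the seed-connected `Q₁` with `#Q₁ ≤ n` only the two main sets `M₁`,
  `M₂` (terms `≥ m ≥ 0`) survive: `≤ -2m e^{-(32+8n)d²βN} restZ(R)`;
* **`sum_large_le`** — the terms with `#Q₁ > n`:
  `≤ 4N² e^{32d²βN} e⁴ (48 d² βN e^{8d²βN})^{n+1} restZ(R)` when `2βN e^{8d²βN} ≤ 1/(24d²)`;
* **`sum_combo_le`**, **`sum_combo_le'`** (clean constants:
  `Σ_{Q ⊆ R} combo(Q) ≤ restZ(R) · (-(2/3) m + 660 N² (144 d² N β)^{n+1})` for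
  `(32+8n) d² N β ≤ 1`, `144 d² N β ≤ 1`) and **`sum_combo_neg`** (`< 0` as soon as
  `660 N² (144 d² N β)^{n+1} < (2/3) m`).

The SHAPE HYPOTHESES (`h11`–`h21`: the pair terms with `#Q ≤ n` vanish except at the two main
sets, each of at most `n` seed-touching plaquettes) are exactly what the cover/tube theorems of the
reduced-half expansions (`TiltedBoxRedSiteTube`, `TiltedBoxRedLinkTube`) provide with `n = 8`.

Sources for the mechanism: Osterwalder–Seiler, Ann. Phys. 110 (1978) 440, §3; Friedli–Velenik
(2017) §5.2. Elementary; no named fact.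
-/


open MeasureTheory Finset Function

namespace Summit.QuantumFields.GaugeBoot

open Literature.MathematicalPhysics.QuantumFieldTheory

noncomputable section

namespace TiltedRP

namespace PairExp

variable {A : Type*} [AddCommGroup A] [Fintype A] [DecidableEq A] {d N : ℕ} {G : Type*} [Group G]
  [TopologicalSpace G] [IsTopologicalGroup G] [CompactSpace G] [MeasurableSpace G] [BorelSpace G]
  [SecondCountableTopology G] (ρ : G →* Matrix (Fin N) (Fin N) ℂ) (e : Fin d → A) (β : ℝ)

/-! ## The estimate -/

section Estimate

variable {u₁ u₂ v₁ v₂ : Plaq A d} {R : Finset (Plaq A d)} (hρ : Continuous ρ)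
  (hβ : 0 ≤ β) (hβN : β * N ≤ 1) {n : ℕ} {M₁ M₂ : Finset (Plaq A d)}
  (hM₁R : M₁ ⊆ R) (hM₂R : M₂ ⊆ R)
  (hM₁K : ∀ q ∈ M₁, Touch e (seedLinks e u₁ u₂ v₁ v₂) q)
  (hM₂K : ∀ q ∈ M₂, Touch e (seedLinks e u₁ u₂ v₁ v₂) q)
  (hM₁n : M₁.card ≤ n) (hM₂n : M₂.card ≤ n)
  (h11 : ∀ Q ⊆ R, Q.card ≤ n → pairT ρ e β Q u₁ v₁ = 0)
  (h22 : ∀ Q ⊆ R, Q.card ≤ n → pairT ρ e β Q u₂ v₂ = 0)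
  (h12 : ∀ Q ⊆ R, Q.card ≤ n → pairT ρ e β Q u₁ v₂ ≠ 0 → Q = M₁)
  (h21 : ∀ Q ⊆ R, Q.card ≤ n → pairT ρ e β Q u₂ v₁ ≠ 0 → Q = M₂)
  {m : ℝ} (hm : 0 ≤ m) (hm₁ : m ≤ pairT ρ e β M₁ u₁ v₂) (hm₂ : m ≤ pairT ρ e β M₂ u₂ v₁)

include hρ hβ hβN hM₁R hM₂R hM₁K hM₂K hM₁n hM₂n h11 h22 h12 h21 hm hm₁ hm₂

omit hβN in
open Classical in
/-- **The small terms**: over the seed-connected `Q₁` with `#Q₁ ≤ n` only the two main sets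
survive, and `Σ_{small} combo(Q₁) restZ(R ∖ N[Q₁]) ≤ -2m e^{-(32+8n)d²βN} restZ(R)`. -/
theorem sum_small_le :
    ∑ Q₁ ∈ (R.powerset.filter (Polymer.IsSeedConn (padj e) (Touch e (seedLinks e u₁ u₂ v₁ v₂)))).filter
        (fun Q₁ => Q₁.card ≤ n),
      combo ρ e β u₁ u₂ v₁ v₂ Q₁ *
        restZ ρ e β (R \ Polymer.snbhd (padj e) (Touch e (seedLinks e u₁ u₂ v₁ v₂)) R Q₁) ≤
      -(2 * m * Real.exp (-((32 + 8 * n) * (d : ℝ) ^ 2 * (β * N)))) * restZ ρ e β R := by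
  set K := seedLinks e u₁ u₂ v₁ v₂ with hK
  set S := (R.powerset.filter (Polymer.IsSeedConn (padj e) (Touch e K))).filter
    (fun Q₁ => Q₁.card ≤ n) with hS
  set Z : Finset (Plaq A d) → ℝ := fun Q₁ =>
    restZ ρ e β (R \ Polymer.snbhd (padj e) (Touch e K) R Q₁) with hZ
  have hmemS : ∀ {Q₁}, Q₁ ∈ S → Q₁ ⊆ R ∧ Q₁.card ≤ n := fun hQ => by
    obtain ⟨h1, h2⟩ := mem_filter.1 hQ
    exact ⟨mem_powerset.1 (mem_filter.1 h1).1, h2⟩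
  have hM₁S : M₁ ∈ S :=
    mem_filter.2 ⟨mem_filter.2 ⟨mem_powerset.2 hM₁R, isSeedConn_of_touch e hM₁K⟩, hM₁n⟩
  have hM₂S : M₂ ∈ S :=
    mem_filter.2 ⟨mem_filter.2 ⟨mem_powerset.2 hM₂R, isSeedConn_of_touch e hM₂K⟩, hM₂n⟩
  -- the small terms are the two cross terms
  have hsmall : ∀ Q₁ ∈ S, combo ρ e β u₁ u₂ v₁ v₂ Q₁ * Z Q₁ =
      -(pairT ρ e β Q₁ u₁ v₂ * Z Q₁) - pairT ρ e β Q₁ u₂ v₁ * Z Q₁ := by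
    intro Q₁ hQ
    obtain ⟨hQR, hQn⟩ := hmemS hQ
    unfold combo
    rw [h11 Q₁ hQR hQn, h22 Q₁ hQR hQn]
    ring
  rw [sum_congr rfl hsmall, sum_sub_distrib, sum_neg_distrib]
  have hsum1 : ∑ Q₁ ∈ S, pairT ρ e β Q₁ u₁ v₂ * Z Q₁ = pairT ρ e β M₁ u₁ v₂ * Z M₁ := by
    refine sum_eq_single_of_mem _ hM₁S fun Q₁ hQ hne => ?_
    obtain ⟨hQR, hQn⟩ := hmemS hQ
    by_cases h0 : pairT ρ e β Q₁ u₁ v₂ = 0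
    · rw [h0, zero_mul]
    · exact absurd (h12 Q₁ hQR hQn h0) hne
  have hsum2 : ∑ Q₁ ∈ S, pairT ρ e β Q₁ u₂ v₁ * Z Q₁ = pairT ρ e β M₂ u₂ v₁ * Z M₂ := by
    refine sum_eq_single_of_mem _ hM₂S fun Q₁ hQ hne => ?_
    obtain ⟨hQR, hQn⟩ := hmemS hQ
    by_cases h0 : pairT ρ e β Q₁ u₂ v₁ = 0
    · rw [h0, zero_mul]
    · exact absurd (h21 Q₁ hQR hQn h0) hne
  rw [hsum1, hsum2]
  have hZ₁ := exp_mul_restZ_le_restZ_off ρ e β (u₁ := u₁) (u₂ := u₂) (v₁ := v₁) (v₂ := v₂)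
    (R := R) hρ hβ hM₁n
  have hZ₂ := exp_mul_restZ_le_restZ_off ρ e β (u₁ := u₁) (u₂ := u₂) (v₁ := v₁) (v₂ := v₂)
    (R := R) hρ hβ hM₂n
  have hZ₁0 : 0 ≤ Z M₁ := (restZ_pos ρ e β hρ _).le
  have hZ₂0 : 0 ≤ Z M₂ := (restZ_pos ρ e β hρ _).le
  have hp1 : m * Z M₁ ≤ pairT ρ e β M₁ u₁ v₂ * Z M₁ := mul_le_mul_of_nonneg_right hm₁ hZ₁0
  have hp2 : m * Z M₂ ≤ pairT ρ e β M₂ u₂ v₁ * Z M₂ := mul_le_mul_of_nonneg_right hm₂ hZ₂0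
  have hq1 : m * (Real.exp (-((32 + 8 * n) * (d : ℝ) ^ 2 * (β * N))) * restZ ρ e β R) ≤ m * Z M₁ :=
    mul_le_mul_of_nonneg_left hZ₁ hm
  have hq2 : m * (Real.exp (-((32 + 8 * n) * (d : ℝ) ^ 2 * (β * N))) * restZ ρ e β R) ≤ m * Z M₂ :=
    mul_le_mul_of_nonneg_left hZ₂ hm
  linarith

omit hM₁R hM₂R hM₁K hM₂K hM₁n hM₂n h11 h22 h12 h21 hm hm₁ hm₂ in
open Classical in
/-- **The large terms**: `Σ_{#Q₁ > n} |combo(Q₁)| restZ(R ∖ N[Q₁]) ≤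
4N² e^{32d²βN} e⁴ (48 d² βN e^{8d²βN})^{n+1} restZ(R)` when `2βN e^{8d²βN} ≤ 1/(24d²)`. -/
theorem sum_large_le (hd : 1 ≤ d)
    (hact : 2 * β * N * Real.exp (8 * (d : ℝ) ^ 2 * (β * N)) ≤ 1 / (24 * (d : ℝ) ^ 2)) :
    ∑ Q₁ ∈ (R.powerset.filter (Polymer.IsSeedConn (padj e) (Touch e (seedLinks e u₁ u₂ v₁ v₂)))).filter
        (fun Q₁ => ¬ Q₁.card ≤ n),
      combo ρ e β u₁ u₂ v₁ v₂ Q₁ *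
        restZ ρ e β (R \ Polymer.snbhd (padj e) (Touch e (seedLinks e u₁ u₂ v₁ v₂)) R Q₁) ≤
      4 * (N : ℝ) ^ 2 * Real.exp (32 * (d : ℝ) ^ 2 * (β * N)) * Real.exp 4 *
        (2 * β * N * Real.exp (8 * (d : ℝ) ^ 2 * (β * N)) * (24 * (d : ℝ) ^ 2)) ^ (n + 1) *
          restZ ρ e β R := by
  set K := seedLinks e u₁ u₂ v₁ v₂ with hK
  set SC := R.powerset.filter (Polymer.IsSeedConn (padj e) (Touch e K)) with hSC
  set S := SC.filter (fun Q₁ => ¬ Q₁.card ≤ n) with hS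
  set y₀ : ℝ := 1 / (24 * (d : ℝ) ^ 2) with hy₀
  set lam : ℝ := 2 * β * N * Real.exp (8 * (d : ℝ) ^ 2 * (β * N)) with hlam
  have hd' : (1 : ℝ) ≤ d := by exact_mod_cast hd
  have hy₀pos : 0 < y₀ := by positivity
  have hlam0 : 0 ≤ lam := by positivity
  have hr1 : lam / y₀ ≤ 1 := (div_le_one hy₀pos).2 hact
  have hr0 : 0 ≤ lam / y₀ := div_nonneg hlam0 hy₀pos.le
  have hZR := (restZ_pos ρ e β hρ R).le
  -- termwise bound
  have hterm : ∀ Q₁ ∈ S, combo ρ e β u₁ u₂ v₁ v₂ Q₁ *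
      restZ ρ e β (R \ Polymer.snbhd (padj e) (Touch e K) R Q₁) ≤
      4 * (N : ℝ) ^ 2 * Real.exp (32 * (d : ℝ) ^ 2 * (β * N)) * (lam / y₀) ^ (n + 1) * restZ ρ e β R *
        y₀ ^ Q₁.card := by
    intro Q₁ hQ
    obtain ⟨-, hQn⟩ := mem_filter.1 hQ
    rw [not_le] at hQn
    have hcombo : |combo ρ e β u₁ u₂ v₁ v₂ Q₁| ≤ 4 * (N : ℝ) ^ 2 * (2 * β * N) ^ Q₁.card := by
      unfold combo
      have b11 := abs_pairT_le ρ e β hρ hβ hβN Q₁ u₁ v₁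
      have b12 := abs_pairT_le ρ e β hρ hβ hβN Q₁ u₁ v₂
      have b21 := abs_pairT_le ρ e β hρ hβ hβN Q₁ u₂ v₁
      have b22 := abs_pairT_le ρ e β hρ hβ hβN Q₁ u₂ v₂
      rw [abs_le] at b11 b12 b21 b22 ⊢
      constructor <;> linarith [b11.1, b11.2, b12.1, b12.2, b21.1, b21.2, b22.1, b22.2]
    have hZle := restZ_off_le ρ e β (u₁ := u₁) (u₂ := u₂) (v₁ := v₁) (v₂ := v₂) (R := R) hρ hβ Q₁
    have hZ0 : 0 ≤ restZ ρ e β (R \ Polymer.snbhd (padj e) (Touch e K) R Q₁) :=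
      (restZ_pos ρ e β hρ _).le
    -- `(2βN)^k (e^{8d²βN})^k = lam^k ≤ (lam/y₀)^{n+1} y₀^k`
    have hpow : (2 * β * N) ^ Q₁.card * Real.exp (8 * (d : ℝ) ^ 2 * (β * N)) ^ Q₁.card ≤
        (lam / y₀) ^ (n + 1) * y₀ ^ Q₁.card := by
      rw [← mul_pow]
      have h1 : lam ^ Q₁.card = (lam / y₀) ^ Q₁.card * y₀ ^ Q₁.card := by
        rw [← mul_pow, div_mul_cancel₀ _ hy₀pos.ne']
      rw [h1]
      exact mul_le_mul_of_nonneg_right (pow_le_pow_of_le_one hr0 hr1 (by omega))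
        (pow_nonneg hy₀pos.le _)
    calc combo ρ e β u₁ u₂ v₁ v₂ Q₁ * restZ ρ e β (R \ Polymer.snbhd (padj e) (Touch e K) R Q₁)
        ≤ |combo ρ e β u₁ u₂ v₁ v₂ Q₁| * restZ ρ e β (R \ Polymer.snbhd (padj e) (Touch e K) R Q₁) :=
          mul_le_mul_of_nonneg_right (le_abs_self _) hZ0
      _ ≤ (4 * (N : ℝ) ^ 2 * (2 * β * N) ^ Q₁.card) *
            (Real.exp (32 * (d : ℝ) ^ 2 * (β * N)) * Real.exp (8 * (d : ℝ) ^ 2 * (β * N)) ^ Q₁.card *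
              restZ ρ e β R) := mul_le_mul hcombo hZle hZ0 (by positivity)
      _ = 4 * (N : ℝ) ^ 2 * Real.exp (32 * (d : ℝ) ^ 2 * (β * N)) * restZ ρ e β R *
            ((2 * β * N) ^ Q₁.card * Real.exp (8 * (d : ℝ) ^ 2 * (β * N)) ^ Q₁.card) := by ring
      _ ≤ 4 * (N : ℝ) ^ 2 * Real.exp (32 * (d : ℝ) ^ 2 * (β * N)) * restZ ρ e β R *
            ((lam / y₀) ^ (n + 1) * y₀ ^ Q₁.card) :=
          mul_le_mul_of_nonneg_left hpow (by positivity)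
      _ = 4 * (N : ℝ) ^ 2 * Real.exp (32 * (d : ℝ) ^ 2 * (β * N)) * (lam / y₀) ^ (n + 1) *
            restZ ρ e β R * y₀ ^ Q₁.card := by ring
  -- sum and entropy
  have hent : ∑ Q₁ ∈ S, y₀ ^ Q₁.card ≤ Real.exp 4 := by
    calc ∑ Q₁ ∈ S, y₀ ^ Q₁.card ≤ ∑ Q₁ ∈ SC, y₀ ^ Q₁.card :=
          sum_le_sum_of_subset_of_nonneg (filter_subset _ _) fun _ _ _ => pow_nonneg hy₀pos.le _
      _ ≤ Real.exp 4 := entropy_le e u₁ u₂ v₁ v₂ R hd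
  have hC : 0 ≤ 4 * (N : ℝ) ^ 2 * Real.exp (32 * (d : ℝ) ^ 2 * (β * N)) * (lam / y₀) ^ (n + 1) *
      restZ ρ e β R := by positivity
  have hlamy : lam / y₀ = lam * (24 * (d : ℝ) ^ 2) := by
    rw [hy₀, div_div_eq_mul_div, div_one]
  calc ∑ Q₁ ∈ S, combo ρ e β u₁ u₂ v₁ v₂ Q₁ * restZ ρ e β (R \ Polymer.snbhd (padj e) (Touch e K) R Q₁)
      ≤ ∑ Q₁ ∈ S, 4 * (N : ℝ) ^ 2 * Real.exp (32 * (d : ℝ) ^ 2 * (β * N)) * (lam / y₀) ^ (n + 1) *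
          restZ ρ e β R * y₀ ^ Q₁.card := sum_le_sum hterm
    _ = 4 * (N : ℝ) ^ 2 * Real.exp (32 * (d : ℝ) ^ 2 * (β * N)) * (lam / y₀) ^ (n + 1) *
          restZ ρ e β R * ∑ Q₁ ∈ S, y₀ ^ Q₁.card := by rw [mul_sum]
    _ ≤ 4 * (N : ℝ) ^ 2 * Real.exp (32 * (d : ℝ) ^ 2 * (β * N)) * (lam / y₀) ^ (n + 1) *
          restZ ρ e β R * Real.exp 4 := mul_le_mul_of_nonneg_left hent hC
    _ = 4 * (N : ℝ) ^ 2 * Real.exp (32 * (d : ℝ) ^ 2 * (β * N)) * Real.exp 4 *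
          (lam * (24 * (d : ℝ) ^ 2)) ^ (n + 1) * restZ ρ e β R := by rw [← hlamy]; ring

open Classical in
/-- ★ **THE VOLUME-INDEPENDENT ESTIMATE on a periodic lattice.** Under the shape hypotheses
(`h11`–`h21`: the terms with `#Q ≤ n` vanish except the two main sets `M₁`, `M₂` of at most `n`
seed-touching plaquettes, whose terms are `≥ m ≥ 0`) and the activity condition
`2βN e^{8d²βN} ≤ 1/(24d²)`:
`Σ_{Q ⊆ R} combo(Q) ≤ restZ(R) · (-2m e^{-(32+8n)d²βN} + 4N² e^{32d²βN} e⁴ (48 d² βN e^{8d²βN})^{n+1})`.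
Nothing on the right depends on `#R` or on the lattice `(A, e)`. -/
theorem sum_combo_le (hd : 1 ≤ d)
    (hact : 2 * β * N * Real.exp (8 * (d : ℝ) ^ 2 * (β * N)) ≤ 1 / (24 * (d : ℝ) ^ 2)) :
    ∑ Q ∈ R.powerset, combo ρ e β u₁ u₂ v₁ v₂ Q ≤
      restZ ρ e β R * (-(2 * m * Real.exp (-((32 + 8 * n) * (d : ℝ) ^ 2 * (β * N)))) +
        4 * (N : ℝ) ^ 2 * Real.exp (32 * (d : ℝ) ^ 2 * (β * N)) * Real.exp 4 *
          (2 * β * N * Real.exp (8 * (d : ℝ) ^ 2 * (β * N)) * (24 * (d : ℝ) ^ 2)) ^ (n + 1)) := by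
  rw [sum_combo_eq_sum_seedConn ρ e β u₁ u₂ v₁ v₂ R hρ, ← sum_filter_add_sum_filter_not _
    (fun Q₁ => Q₁.card ≤ n)]
  have h1 := sum_small_le ρ e β hρ hβ hM₁R hM₂R hM₁K hM₂K hM₁n hM₂n h11 h22 h12 h21 hm hm₁ hm₂
  have h2 := sum_large_le ρ e β (u₁ := u₁) (u₂ := u₂) (v₁ := v₁) (v₂ := v₂) (R := R) (n := n)
    hρ hβ hβN hd hact
  linarith

/-- ★ **THE VOLUME-INDEPENDENT ESTIMATE, clean constants.** For `(32+8n) d² N β ≤ 1` and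
`144 d² N β ≤ 1`: `Σ_{Q ⊆ R} combo(Q) ≤ restZ(R) · (-(2/3) m + 660 N² (144 d² N β)^{n+1})`,
on any periodic lattice `(A, e)`. -/
theorem sum_combo_le' (hd : 1 ≤ d) (hβ1 : (32 + 8 * n) * (d : ℝ) ^ 2 * N * β ≤ 1)
    (hβ2 : 144 * (d : ℝ) ^ 2 * N * β ≤ 1) :
    ∑ Q ∈ R.powerset, combo ρ e β u₁ u₂ v₁ v₂ Q ≤
      restZ ρ e β R * (-(2 / 3 * m) + 660 * (N : ℝ) ^ 2 * (144 * (d : ℝ) ^ 2 * N * β) ^ (n + 1)) := by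
  have hd' : (1 : ℝ) ≤ d := by exact_mod_cast hd
  have hd2 : 1 ≤ (d : ℝ) ^ 2 := by nlinarith
  have hβN0 : 0 ≤ β * N := mul_nonneg hβ (Nat.cast_nonneg N)
  have he3 : Real.exp 1 ≤ 3 := by
    have h := Real.exp_one_lt_d9; norm_num at h; linarith
  -- `8 d² βN ≤ 1/18 ≤ 1`, `32 d² βN ≤ 1`
  have hX0 : 0 ≤ (d : ℝ) ^ 2 * (β * N) := by positivity
  have e144 : 144 * (d : ℝ) ^ 2 * N * β = 144 * ((d : ℝ) ^ 2 * (β * N)) := by ring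
  have h8 : 8 * (d : ℝ) ^ 2 * (β * N) ≤ 1 := by
    have e' : 8 * (d : ℝ) ^ 2 * (β * N) = 8 * ((d : ℝ) ^ 2 * (β * N)) := by ring
    linarith
  have h32 : 32 * (d : ℝ) ^ 2 * (β * N) ≤ 1 := by
    have e' : 32 * (d : ℝ) ^ 2 * (β * N) = 32 * ((d : ℝ) ^ 2 * (β * N)) := by ring
    linarith
  have hE8 : Real.exp (8 * (d : ℝ) ^ 2 * (β * N)) ≤ 3 :=
    ((Real.exp_le_exp.2 h8).trans he3)
  have hE32 : Real.exp (32 * (d : ℝ) ^ 2 * (β * N)) ≤ 3 :=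
    ((Real.exp_le_exp.2 h32).trans he3)
  have hE4 : Real.exp 4 ≤ 55 := by
    have h := Real.exp_one_lt_d9
    have h4 : Real.exp 4 = Real.exp 1 ^ 4 := by rw [← Real.exp_nat_mul]; norm_num
    have h0 : 0 ≤ Real.exp 1 := Real.exp_nonneg 1
    have h27 : Real.exp 1 ≤ 2.72 := by linarith
    rw [h4]
    calc Real.exp 1 ^ 4 ≤ (2.72 : ℝ) ^ 4 := pow_le_pow_left₀ h0 h27 4
      _ ≤ 55 := by norm_num
  have hEm : 1 / 3 ≤ Real.exp (-((32 + 8 * n) * (d : ℝ) ^ 2 * (β * N))) := by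
    have h1 : -1 ≤ -((32 + 8 * n) * (d : ℝ) ^ 2 * (β * N)) := by
      have e' : (32 + 8 * n) * (d : ℝ) ^ 2 * (β * N) = (32 + 8 * n) * (d : ℝ) ^ 2 * N * β := by ring
      linarith
    refine le_trans ?_ (Real.exp_le_exp.2 h1)
    rw [Real.exp_neg, one_div]
    exact inv_anti₀ (Real.exp_pos 1) he3
  -- the activity condition
  have hlam : 2 * β * N * Real.exp (8 * (d : ℝ) ^ 2 * (β * N)) * (24 * (d : ℝ) ^ 2) ≤
      144 * (d : ℝ) ^ 2 * N * β := by
    have : 2 * β * N * Real.exp (8 * (d : ℝ) ^ 2 * (β * N)) * (24 * (d : ℝ) ^ 2) =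
        (48 * (d : ℝ) ^ 2 * N * β) * Real.exp (8 * (d : ℝ) ^ 2 * (β * N)) := by ring
    rw [this]
    have h0 : (0 : ℝ) ≤ 48 * (d : ℝ) ^ 2 * N * β := by positivity
    have h := mul_le_mul_of_nonneg_left hE8 h0
    linarith
  have hact : 2 * β * N * Real.exp (8 * (d : ℝ) ^ 2 * (β * N)) ≤ 1 / (24 * (d : ℝ) ^ 2) := by
    rw [le_div_iff₀ (by positivity)]
    exact hlam.trans hβ2
  have h := sum_combo_le ρ e β hρ hβ hβN hM₁R hM₂R hM₁K hM₂K hM₁n hM₂n h11 h22 h12 h21 hm hm₁ hm₂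
    hd hact
  refine h.trans (mul_le_mul_of_nonneg_left ?_ (restZ_pos ρ e β hρ R).le)
  have hlam0 : 0 ≤ 2 * β * N * Real.exp (8 * (d : ℝ) ^ 2 * (β * N)) * (24 * (d : ℝ) ^ 2) := by
    positivity
  have hp : (2 * β * N * Real.exp (8 * (d : ℝ) ^ 2 * (β * N)) * (24 * (d : ℝ) ^ 2)) ^ (n + 1) ≤
      (144 * (d : ℝ) ^ 2 * N * β) ^ (n + 1) := pow_le_pow_left₀ hlam0 hlam _
  have hp0 : 0 ≤ (144 * (d : ℝ) ^ 2 * N * β) ^ (n + 1) := by positivity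
  have hN0 : 0 ≤ 4 * (N : ℝ) ^ 2 := by positivity
  have hmain : 2 / 3 * m ≤ 2 * m * Real.exp (-((32 + 8 * n) * (d : ℝ) ^ 2 * (β * N))) := by
    have h := mul_le_mul_of_nonneg_left hEm (by positivity : (0 : ℝ) ≤ 2 * m)
    linarith
  have htail : 4 * (N : ℝ) ^ 2 * Real.exp (32 * (d : ℝ) ^ 2 * (β * N)) * Real.exp 4 *
      (2 * β * N * Real.exp (8 * (d : ℝ) ^ 2 * (β * N)) * (24 * (d : ℝ) ^ 2)) ^ (n + 1) ≤
      660 * (N : ℝ) ^ 2 * (144 * (d : ℝ) ^ 2 * N * β) ^ (n + 1) := by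
    calc 4 * (N : ℝ) ^ 2 * Real.exp (32 * (d : ℝ) ^ 2 * (β * N)) * Real.exp 4 *
          (2 * β * N * Real.exp (8 * (d : ℝ) ^ 2 * (β * N)) * (24 * (d : ℝ) ^ 2)) ^ (n + 1)
        ≤ 4 * (N : ℝ) ^ 2 * 3 * 55 * (144 * (d : ℝ) ^ 2 * N * β) ^ (n + 1) := by
          have h1 : 4 * (N : ℝ) ^ 2 * Real.exp (32 * (d : ℝ) ^ 2 * (β * N)) ≤ 4 * (N : ℝ) ^ 2 * 3 :=
            mul_le_mul_of_nonneg_left hE32 hN0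
          have h2 : 4 * (N : ℝ) ^ 2 * Real.exp (32 * (d : ℝ) ^ 2 * (β * N)) * Real.exp 4 ≤
              4 * (N : ℝ) ^ 2 * 3 * 55 :=
            mul_le_mul h1 hE4 (Real.exp_nonneg _) (by positivity)
          exact mul_le_mul h2 hp (by positivity) (by positivity)
      _ = 660 * (N : ℝ) ^ 2 * (144 * (d : ℝ) ^ 2 * N * β) ^ (n + 1) := by ring
  linarith

/-- ★ **Negativity.** If moreover `660 N² (144 d² N β)^{n+1} < (2/3) m`, the expanded pairing is
NEGATIVE on any periodic lattice `(A, e)`: `Σ_{Q ⊆ R} combo(Q) < 0`. -/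
theorem sum_combo_neg (hd : 1 ≤ d) (hβ1 : (32 + 8 * n) * (d : ℝ) ^ 2 * N * β ≤ 1)
    (hβ2 : 144 * (d : ℝ) ^ 2 * N * β ≤ 1)
    (hwin : 660 * (N : ℝ) ^ 2 * (144 * (d : ℝ) ^ 2 * N * β) ^ (n + 1) < 2 / 3 * m) :
    ∑ Q ∈ R.powerset, combo ρ e β u₁ u₂ v₁ v₂ Q < 0 := by
  have h := sum_combo_le' ρ e β hρ hβ hβN hM₁R hM₂R hM₁K hM₂K hM₁n hM₂n h11 h22 h12 h21 hm hm₁ hm₂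
    hd hβ1 hβ2
  have hZ := restZ_pos ρ e β hρ R
  have hneg : -(2 / 3 * m) + 660 * (N : ℝ) ^ 2 * (144 * (d : ℝ) ^ 2 * N * β) ^ (n + 1) < 0 := by
    linarith
  exact h.trans_lt (mul_neg_of_pos_of_neg hZ hneg)

end Estimate

end PairExp

end TiltedRP

end

end Summit.QuantumFields.GaugeBoot
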